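import Literature.Combinatorics.StablePolynomials.RightHalfPlaneStabilityPreservers
import Literature.Combinatorics.StablePolynomials.MasterCompositionMultivariate
import HarnessLib

/-!
# The "fold mod 2" operator preserves weak Hurwitz stability (Borcea–Brändén II, §8.4)

J. Borcea, P. Brändén, *The Lee–Yang and Pólya–Schur programs. II.*, Comm. Pure Appl. Math. 62 (2009)
1595–1631 (arXiv:0809.3087), §8.4:

> The linear operator `MOD : ℂ[z_1,…,z_n] → ℂ_{(1ⁿ)}[z_1,…,z_n]` "folds mod 2" the powers in the Taylor expansion
> of a polynomial, i.e., if `f(z) = Σ_α a(α) z^α` then `MOD(f)(z) = Σ_α a(α) z^{α mod 2}`, where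
> `α mod 2 = (α_1 mod 2,…,α_n mod 2)`. The algebraic symbol of `MOD` (up to degree `κ`) with respect to the open
> right half-plane `H_{π/2}` (cf. Theorem 3.2) is
> `MOD[(1+zw)^κ] = 2^{-n} (1+w)^κ (1+z)^{[n]} Π_i [1 + ((1-w_i)/(1+w_i))^{κ_i} (1-z_i)/(1+z_i)]`.
> If `Re ζ > 0` then `|(1-ζ)/(1+ζ)| < 1` so the above symbol is weakly Hurwitz stable. By Theorem 3.2 we
> conclude that `MOD` preserves weak Hurwitz stability.

The symbol is used in the equivalent polynomial form
`MOD[Π_i(1+w_iz_i)^{κ_i}](z) = Π_i ½[(1+w_i)^{κ_i}(1+z_i) + (1-w_i)^{κ_i}(1-z_i)]`, non-vanishing because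
`|1-ζ| < |1+ζ|` for `Re ζ > 0`; Theorem 3.2 (`C = H_{π/2}`, `BorceaBranden_rightHalfPlaneStabilityPreserver_iff`) is
applied in degree `κ = deg f`, so the conclusion holds for every polynomial `f`.

## Contents

* `foldMod2`, `foldMod2_monomial`, `foldMod2_prod_X_pow`.
* `two_mul_sum_choose_mul_pow_mul_pow_mod_two` (`2Σ_a binom(κ,a) w^a z^{a mod 2} = (1+w)^κ(1+z) + (1-w)^κ(1-z)`),
  **`eval_foldMod2_symbol`**, `norm_one_sub_lt_norm_one_add`, `isHThetaStable_boundedDegreeSymbolD_foldMod2`,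
  **`foldMod2_weaklyHurwitzStable`** (`MOD` preserves weak Hurwitz stability).

## References

* [BorceaBranden2009II] J. Borcea, P. Brändén, Comm. Pure Appl. Math. 62 (2009) 1595–1631, §8.4 (the operator
  `MOD`).
-/

noncomputable section

open MvPolynomial Finset

namespace Literature.Combinatorics.StablePolynomials

variable {σ : Type*} [Fintype σ] [DecidableEq σ]

/-! ## §1 The operator `MOD` -/

section Def

/-- **`MOD`, folding exponents mod 2**: the linear map `z^α ↦ z^{α mod 2}`.
[cite: BorceaBranden2009II, §8.4 (definition of `MOD`)] -/
def foldMod2 : MvPolynomial σ ℂ →ₗ[ℂ] MvPolynomial σ ℂ :=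
  (basisMonomials σ ℂ).constr ℂ fun s => monomial (Finsupp.mapRange (· % 2) (by simp) s) (1 : ℂ)

omit [Fintype σ] [DecidableEq σ] in
/-- `MOD(c z^α) = c z^{α mod 2}`. [cite: BorceaBranden2009II, §8.4 (definition of `MOD`)] -/
theorem foldMod2_monomial (s : σ →₀ ℕ) (c : ℂ) :
    foldMod2 (monomial s c) = monomial (Finsupp.mapRange (· % 2) (by simp) s) c := by
  have h : (monomial s c : MvPolynomial σ ℂ) = c • basisMonomials σ ℂ s := by
    rw [coe_basisMonomials, smul_monomial, smul_eq_mul, mul_one]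
  rw [h, map_smul, foldMod2, Module.Basis.constr_basis, smul_monomial, smul_eq_mul, mul_one]

omit [DecidableEq σ] in
/-- `MOD(Π_i z_i^{α_i}) = Π_i z_i^{α_i mod 2}`. [cite: BorceaBranden2009II, §8.4 (definition of `MOD`)] -/
theorem foldMod2_prod_X_pow (α : σ → ℕ) :
    foldMod2 (∏ i, X i ^ α i : MvPolynomial σ ℂ) = ∏ i, X i ^ (α i % 2) := by
  rw [prod_X_pow_eq_monomial_toF, foldMod2_monomial, prod_X_pow_eq_monomial_toF (fun i => α i % 2)]
  have h : Finsupp.mapRange (· % 2) (by simp) (toF α) = toF fun i => α i % 2 := by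
    ext i
    rw [Finsupp.mapRange_apply, toF_apply, toF_apply]
  rw [h]

end Def

/-! ## §2 The symbol and weak Hurwitz stability -/

section Symbol

omit [Fintype σ] [DecidableEq σ] in
/-- **`2 Σ_{a≤κ} binom(κ,a) w^a z^{a mod 2} = (1+w)^κ (1+z) + (1-w)^κ (1-z)`** (the one-variable symbol of `MOD`).
[cite: BorceaBranden2009II, §8.4 (the displayed symbol `MOD[(1+zw)^κ]`)] -/
theorem two_mul_sum_choose_mul_pow_mul_pow_mod_two (κ : ℕ) (w z : ℂ) :
    2 * ∑ a ∈ range (κ + 1), ((κ.choose a : ℕ) : ℂ) * w ^ a * z ^ (a % 2) =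
      (1 + w) ^ κ * (1 + z) + (1 - w) ^ κ * (1 - z) := by
  rw [add_comm (1 : ℂ) w, sub_eq_add_neg (1 : ℂ) w, add_comm (1 : ℂ) (-w), add_pow, add_pow, sum_mul, sum_mul,
    mul_sum, ← sum_add_distrib]
  refine sum_congr rfl fun a _ => ?_
  simp only [one_pow, mul_one]
  rcases Nat.even_or_odd a with ha | ha
  · rw [Nat.even_iff.1 ha, pow_zero, ha.neg_pow]
    ring
  · rw [Nat.odd_iff.1 ha, pow_one, ha.neg_pow]
    ring

/-- **The symbol of `MOD`**: `MOD[Π_i(1+w_iz_i)^{κ_i}](z) = Π_i ½[(1+w_i)^{κ_i}(1+z_i) + (1-w_i)^{κ_i}(1-z_i)]`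
(`= 2^{-n}(1+w)^κ(1+z)^{[n]} Π_i[1 + ((1-w_i)/(1+w_i))^{κ_i}(1-z_i)/(1+z_i)]`).
[cite: BorceaBranden2009II, §8.4 (the symbol `MOD[(1+zw)^κ]`)] -/
theorem eval_foldMod2_symbol (κ : σ → ℕ) (z w : σ → ℂ) :
    eval z (foldMod2 (∏ i, (1 + C (w i) * X i) ^ κ i)) =
      ∏ i, (2 : ℂ)⁻¹ * ((1 + w i) ^ κ i * (1 + z i) + (1 - w i) ^ κ i * (1 - z i)) := by
  rw [apply_prod_one_add_C_mul_X_pow, map_sum]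
  have hterm : ∀ α ∈ Fintype.piFinset (fun i => range (κ i + 1)),
      eval z ((∏ i, (((κ i).choose (α i) : ℕ) : ℂ) * w i ^ α i) • foldMod2 (∏ i, X i ^ α i)) =
        ∏ i, ((((κ i).choose (α i) : ℕ) : ℂ) * w i ^ α i * z i ^ (α i % 2)) := by
    intro α _
    rw [foldMod2_prod_X_pow, smul_eval, _root_.map_prod]
    simp only [map_pow, eval_X]
    rw [← prod_mul_distrib]
  rw [sum_congr rfl hterm, ← prod_univ_sum (fun i => range (κ i + 1))
    fun i a => (((κ i).choose a : ℕ) : ℂ) * w i ^ a * z i ^ (a % 2)]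
  refine prod_congr rfl fun i _ => ?_
  rw [← two_mul_sum_choose_mul_pow_mul_pow_mod_two, ← mul_assoc, inv_mul_cancel₀ two_ne_zero, one_mul]

omit [Fintype σ] [DecidableEq σ] in
/-- **`|1 - ζ| < |1 + ζ|` for `Re ζ > 0`** (equivalently `|(1-ζ)/(1+ζ)| < 1`).
[cite: BorceaBranden2009II, §8.4 ("If `Re ζ > 0` then `|(1-ζ)/(1+ζ)| < 1`")] -/
theorem norm_one_sub_lt_norm_one_add {ζ : ℂ} (h : 0 < ζ.re) : ‖1 - ζ‖ < ‖1 + ζ‖ := by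
  rw [← abs_norm (1 - ζ), ← abs_norm (1 + ζ), ← sq_lt_sq, ← Complex.normSq_eq_norm_sq,
    ← Complex.normSq_eq_norm_sq]
  simp only [Complex.normSq_apply, Complex.sub_re, Complex.add_re, Complex.one_re, Complex.sub_im,
    Complex.add_im, Complex.one_im]
  nlinarith

/-- **The symbol of `MOD` is weakly Hurwitz stable.** [cite: BorceaBranden2009II, §8.4 ("the above symbol is
weakly Hurwitz stable")] -/
theorem isHThetaStable_boundedDegreeSymbolD_foldMod2 (κ : σ → ℕ) :
    IsHThetaStable (Real.pi / 2) (boundedDegreeSymbolD κ (foldMod2 (σ := σ))) := by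
  rw [isHThetaStable_pi_div_two_iff]
  intro zw hzw
  rw [← Sum.elim_comp_inl_inr zw, eval_boundedDegreeSymbolD, eval_foldMod2_symbol]
  refine prod_ne_zero_iff.2 fun i _ => mul_ne_zero (inv_ne_zero two_ne_zero) fun h => ?_
  set z : ℂ := (zw ∘ Sum.inl) i with hz
  set w : ℂ := (zw ∘ Sum.inr) i with hw
  have hzr : 0 < z.re := hzw _
  have hwr : 0 < w.re := hzw _
  -- `|(1-w)^κ (1-z)| < |(1+w)^κ (1+z)|`
  have hlt : ‖(1 - w) ^ κ i * (1 - z)‖ < ‖(1 + w) ^ κ i * (1 + z)‖ := by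
    rw [norm_mul, norm_mul, norm_pow, norm_pow]
    have h1 : ‖1 - w‖ ^ κ i ≤ ‖1 + w‖ ^ κ i :=
      pow_le_pow_left₀ (norm_nonneg _) (norm_one_sub_lt_norm_one_add hwr).le _
    have h2 := norm_one_sub_lt_norm_one_add hzr
    have h3 : 0 < ‖1 + w‖ ^ κ i := pow_pos ((norm_nonneg _).trans_lt (norm_one_sub_lt_norm_one_add hwr)) _
    calc ‖1 - w‖ ^ κ i * ‖1 - z‖ ≤ ‖1 + w‖ ^ κ i * ‖1 - z‖ := by gcongr
      _ < ‖1 + w‖ ^ κ i * ‖1 + z‖ := by gcongr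
  have heq : (1 + w) ^ κ i * (1 + z) = -((1 - w) ^ κ i * (1 - z)) := by linear_combination h
  rw [heq, norm_neg] at hlt
  exact lt_irrefl _ hlt

/-- **Borcea–Brändén II, §8.4: `MOD` preserves weak Hurwitz stability** — for every weakly Hurwitz stable `f`,
`MOD(f)` is weakly Hurwitz stable or identically `0` (Theorem 3.2 for `C = H_{π/2}` in degree `κ = deg f`).
[cite: BorceaBranden2009II, §8.4 ("we conclude that `MOD` preserves weak Hurwitz stability")] -/
theorem foldMod2_weaklyHurwitzStable {f : MvPolynomial σ ℂ} (hf : IsHThetaStable (Real.pi / 2) f) :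
    IsHThetaStable (Real.pi / 2) (foldMod2 f) ∨ foldMod2 f = 0 :=
  (BorceaBranden_rightHalfPlaneStabilityPreserver_iff (fun i => degreeOf i f) (foldMod2 (σ := σ))).2
    (Or.inr (isHThetaStable_boundedDegreeSymbolD_foldMod2 _)) f (fun _ => le_rfl) hf

end Symbol

end Literature.Combinatorics.StablePolynomials

end
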